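/-
Soloist `solo-ValiantsHypothesis-informed`, session 37 — the syzygy stratification (note
`paper/quadspan.md`, item 2.73): on the stratum of spaces `W ⊂ F[X]` whose multiplication map
`Sym W → F[X]` has no kernel in degree `2k`, a monomial target `X^e ∈ W·W` whose representing
quadratic form is irreducible ("dishonest" target) takes part in no balanced additive relation of
weight `≤ 2k` among represented exponents except on both sides.  Dishonest targets are
automatically Sidon (`k = 2`), automatically `B_k` in general.
-/
import Mathlib
import Summits.ValiantsHypothesis.ValiantsHypothesis.Theorems.SoloInformedUnivariatePolynomial

/-!
# Dishonest targets are automatically Sidon on the injective stratum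

Setting (soloist note `paper/quadspan.md`, item 2.73; the univariate window reduction is
`soloInformed_valiantsHypothesis_of_unipolyLogOrderBound`).  `w : Fin s → F[X]` spans a space `W`
of univariate polynomials and `μ := MvPolynomial.aeval w : F[z₁,…,z_s] → F[X]` is the evaluation
map, i.e. the multiplication map `Sym W → F[X]`.  A monomial `X^e ∈ W·W` is *represented* by a
quadratic form `q` with `μ q = X^e`.  When `μ` is injective on quadratic forms the representing
form `q_e` is unique, and `X^e` is an *honest* target (`e = a + a'` with `X^a, X^{a'} ∈ W` up to
the obvious normalisation) iff `q_e` is reducible; the honest targets live in a sumset `A + A`,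
where the sumset girth bound `soloInformed_sumsetGirth` applies.  The theorems below say that on
the stratum where `μ` is injective in degree `2k` the *dishonest* targets carry no balanced
additive structure of weight `≤ 2k` at all.

**Theorem (`soloInformed_eq_or_eq_of_quarticInjective`).**  Suppose `μ` is injective on forms of
degree `4`.  Let `X^a, X^b, X^c, X^d` be represented by quadratic forms `qa, qb, qc, qd` with `qa`
irreducible, and `a + b = c + d`.  Then `a = c` or `a = d`.

*Proof.*  `qa·qb − qc·qd` is a quartic form in `ker μ`, hence `qa·qb = qc·qd`.  `F[z]` is a UFD, so
the irreducible `qa` is prime and divides `qc`, say; in a domain total degrees add, so the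
cofactor is a nonzero constant `r`, and `X^c = μ qc = r · X^a` forces `c = a`.  ∎

**Theorem (`soloInformed_mem_of_balanced_of_injective`).**  Suppose `μ` is injective on forms of
degree `2k`, and let `S, T` be two multisets of `k` represented exponents with `Σ S = Σ T`.  Every
`a ∈ S` whose representing form is irreducible lies in `T`.  (Cancelling and inducting: the
dishonest part of any balanced relation of weight `≤ 2k` cancels out, i.e. such relations are
supported on the honest part.)

**Corollary (`soloInformed_sidon_of_quarticInjective`).**  `a + b = c + d` among represented
exponents with `qa` irreducible forces `{a, b} = {c, d}`.
-/

namespace Summit.ValiantsHypothesis.ValiantsHypothesis.Theorems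

open MvPolynomial Polynomial

variable {F : Type*} [Field F] {s : ℕ}

/-- A quadratic form representing `X^e` can divide a quadratic form representing `X^f` only if
`e = f`: the cofactor is a nonzero constant. -/
theorem solo_exp_eq_of_dvd_of_isHomogeneous_two (w : Fin s → F[X])
    {q q' : MvPolynomial (Fin s) F} {e f : ℕ}
    (hq : q.IsHomogeneous 2) (hq' : q'.IsHomogeneous 2)
    (he : MvPolynomial.aeval w q = (X : F[X]) ^ e)
    (hf : MvPolynomial.aeval w q' = (X : F[X]) ^ f)
    (hdvd : q ∣ q') : e = f := by
  obtain ⟨u, hu⟩ := hdvd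
  have hq0 : q ≠ 0 := by
    rintro rfl
    rw [map_zero] at he
    exact pow_ne_zero e Polynomial.X_ne_zero he.symm
  have hq'0 : q' ≠ 0 := by
    rintro rfl
    rw [map_zero] at hf
    exact pow_ne_zero f Polynomial.X_ne_zero hf.symm
  have hu0 : u ≠ 0 := by
    rintro rfl
    exact hq'0 (by simpa using hu)
  have hdeg : u.totalDegree = 0 := by
    have h1 : q'.totalDegree = q.totalDegree + u.totalDegree := by
      rw [hu]; exact totalDegree_mul_of_isDomain hq0 hu0
    rw [hq.totalDegree hq0, hq'.totalDegree hq'0] at h1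
    omega
  rw [totalDegree_eq_zero_iff_eq_C] at hdeg
  obtain ⟨r, hur⟩ : ∃ r : F, u = MvPolynomial.C r := ⟨u.coeff 0, hdeg⟩
  have key : (X : F[X]) ^ f = Polynomial.C r * (X : F[X]) ^ e := by
    rw [← hf, hu, hur, map_mul, he, MvPolynomial.aeval_C, ← Polynomial.C_eq_algebraMap, mul_comm]
  have hr : r ≠ 0 := by
    intro h0
    rw [h0, map_zero, zero_mul] at key
    exact pow_ne_zero f Polynomial.X_ne_zero key
  have hnat := congrArg Polynomial.natDegree key
  rw [Polynomial.natDegree_X_pow, Polynomial.natDegree_C_mul_X_pow _ _ hr] at hnat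
  exact hnat.symm

/-- **Quartic-injective stratum: an irreducible target meets an additive quadruple only
trivially.**  If `aeval w` kills no nonzero quartic form, `X^a, X^b, X^c, X^d` are represented by
quadratic forms, `qa` is irreducible and `a + b = c + d`, then `a = c ∨ a = d`. -/
theorem soloInformed_eq_or_eq_of_quarticInjective (w : Fin s → F[X])
    (hinj : ∀ x : MvPolynomial (Fin s) F, x.IsHomogeneous 4 → MvPolynomial.aeval w x = 0 → x = 0)
    {qa qb qc qd : MvPolynomial (Fin s) F} {a b c d : ℕ}
    (ha2 : qa.IsHomogeneous 2) (hb2 : qb.IsHomogeneous 2) (hc2 : qc.IsHomogeneous 2)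
    (hd2 : qd.IsHomogeneous 2)
    (ha : MvPolynomial.aeval w qa = (X : F[X]) ^ a) (hb : MvPolynomial.aeval w qb = (X : F[X]) ^ b)
    (hc : MvPolynomial.aeval w qc = (X : F[X]) ^ c) (hd : MvPolynomial.aeval w qd = (X : F[X]) ^ d)
    (hirr : Irreducible qa) (h : a + b = c + d) : a = c ∨ a = d := by
  have hprod : qa * qb = qc * qd := by
    have h4 : (qa * qb - qc * qd).IsHomogeneous 4 := (ha2.mul hb2).sub (hc2.mul hd2)
    have h0 : MvPolynomial.aeval w (qa * qb - qc * qd) = 0 := by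
      rw [map_sub, map_mul, map_mul, ha, hb, hc, hd, ← pow_add, ← pow_add, h, sub_self]
    exact sub_eq_zero.mp (hinj _ h4 h0)
  have hprime : Prime qa := UniqueFactorizationMonoid.irreducible_iff_prime.mp hirr
  have hdvd : qa ∣ qc * qd := ⟨qb, hprod.symm⟩
  rcases hprime.dvd_or_dvd hdvd with h1 | h1
  · exact Or.inl (solo_exp_eq_of_dvd_of_isHomogeneous_two w ha2 hc2 ha hc h1)
  · exact Or.inr (solo_exp_eq_of_dvd_of_isHomogeneous_two w ha2 hd2 ha hd h1)

/-- **Dishonest targets are automatically Sidon.**  On the quartic-injective stratum, if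
`E ⊆ ℕ` is a set of exponents each represented by a quadratic form `q e` (`aeval w (q e) = X^e`),
then `a + b = c + d` in `E` with `q a` irreducible forces `{a, b} = {c, d}`. -/
theorem soloInformed_sidon_of_quarticInjective (w : Fin s → F[X])
    (hinj : ∀ x : MvPolynomial (Fin s) F, x.IsHomogeneous 4 → MvPolynomial.aeval w x = 0 → x = 0)
    (q : ℕ → MvPolynomial (Fin s) F) (E : Set ℕ)
    (h2 : ∀ e ∈ E, (q e).IsHomogeneous 2)
    (hval : ∀ e ∈ E, MvPolynomial.aeval w (q e) = (X : F[X]) ^ e)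
    {a b c d : ℕ} (ha : a ∈ E) (hb : b ∈ E) (hc : c ∈ E) (hd : d ∈ E)
    (hirr : Irreducible (q a)) (h : a + b = c + d) :
    (a = c ∧ b = d) ∨ (a = d ∧ b = c) := by
  rcases soloInformed_eq_or_eq_of_quarticInjective w hinj (h2 a ha) (h2 b hb) (h2 c hc) (h2 d hd)
      (hval a ha) (hval b hb) (hval c hc) (hval d hd) hirr h with h1 | h1
  · exact Or.inl ⟨h1, by omega⟩
  · exact Or.inr ⟨h1, by omega⟩

/-- A product of forms of degree `n` over a multiset is a form of degree `card · n`. -/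
theorem solo_isHomogeneous_multiset_prod {σ R : Type*} [CommSemiring R]
    (S : Multiset (MvPolynomial σ R)) (n : ℕ) (h : ∀ x ∈ S, x.IsHomogeneous n) :
    S.prod.IsHomogeneous (Multiset.card S * n) := by
  induction S using Multiset.induction_on with
  | empty => simpa using MvPolynomial.isHomogeneous_one σ R
  | cons a S ih =>
    rw [Multiset.prod_cons, Multiset.card_cons,
      show (Multiset.card S + 1) * n = n + Multiset.card S * n by ring]
    exact (h a (Multiset.mem_cons_self a S)).mul
      (ih fun x hx => h x (Multiset.mem_cons_of_mem hx))

/-- `∏_{e ∈ S} X^e = X^{Σ S}` over a multiset of exponents. -/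
theorem solo_multiset_prod_X_pow {R : Type*} [CommSemiring R] (S : Multiset ℕ) :
    (S.map fun e => (X : R[X]) ^ e).prod = (X : R[X]) ^ S.sum := by
  induction S using Multiset.induction_on with
  | empty => simp
  | cons a S ih => simp [pow_add, ih]

/-- **Degree-`2k` injective stratum: an irreducible target cancels out of every balanced relation
of weight `≤ 2k`.**  If `aeval w` kills no nonzero form of degree `2k`, `S` and `T` are multisets
of `k` represented exponents with equal sums, and `a ∈ S` has an irreducible representing form,
then `a ∈ T`. -/
theorem soloInformed_mem_of_balanced_of_injective (w : Fin s → F[X]) (k : ℕ)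
    (hinj : ∀ x : MvPolynomial (Fin s) F, x.IsHomogeneous (2 * k) →
      MvPolynomial.aeval w x = 0 → x = 0)
    (q : ℕ → MvPolynomial (Fin s) F) (E : Set ℕ)
    (h2 : ∀ e ∈ E, (q e).IsHomogeneous 2)
    (hval : ∀ e ∈ E, MvPolynomial.aeval w (q e) = (X : F[X]) ^ e)
    (S T : Multiset ℕ) (hS : ∀ e ∈ S, e ∈ E) (hT : ∀ e ∈ T, e ∈ E)
    (hSk : Multiset.card S = k) (hTk : Multiset.card T = k) (hsum : S.sum = T.sum)
    {a : ℕ} (haS : a ∈ S) (hirr : Irreducible (q a)) : a ∈ T := by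
  have hhom : ∀ U : Multiset ℕ, (∀ e ∈ U, e ∈ E) → Multiset.card U = k →
      (U.map q).prod.IsHomogeneous (2 * k) := by
    intro U hU hUk
    have := solo_isHomogeneous_multiset_prod (U.map q) 2 (by
      intro x hx
      obtain ⟨e, he, rfl⟩ := Multiset.mem_map.mp hx
      exact h2 e (hU e he))
    rwa [Multiset.card_map, hUk, mul_comm] at this
  have hev : ∀ U : Multiset ℕ, (∀ e ∈ U, e ∈ E) →
      MvPolynomial.aeval w (U.map q).prod = (X : F[X]) ^ U.sum := by
    intro U hU
    rw [map_multiset_prod, Multiset.map_map, ← solo_multiset_prod_X_pow]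
    congr 1
    exact Multiset.map_congr rfl fun e he => hval e (hU e he)
  have hprod : (S.map q).prod = (T.map q).prod := by
    have h0 : MvPolynomial.aeval w ((S.map q).prod - (T.map q).prod) = 0 := by
      rw [map_sub, hev S hS, hev T hT, hsum, sub_self]
    exact sub_eq_zero.mp (hinj _ ((hhom S hS hSk).sub (hhom T hT hTk)) h0)
  have hprime : Prime (q a) := UniqueFactorizationMonoid.irreducible_iff_prime.mp hirr
  have hdvd : q a ∣ (T.map q).prod := by
    rw [← hprod]
    exact Multiset.dvd_prod (Multiset.mem_map_of_mem q haS)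
  obtain ⟨x, hx, hdx⟩ := hprime.exists_mem_multiset_dvd hdvd
  obtain ⟨t, ht, rfl⟩ := Multiset.mem_map.mp hx
  have hat : a = t := solo_exp_eq_of_dvd_of_isHomogeneous_two w (h2 a (hS a haS)) (h2 t (hT t ht))
    (hval a (hS a haS)) (hval t (hT t ht)) hdx
  exact hat ▸ ht

/-- Every element of the span of the pairwise products `b_i b_j` is represented by a quadratic
form: `x = aeval b q` with `q` homogeneous of degree `2`. -/
theorem solo_exists_quadForm_of_mem_span {K : Type*} [Field K] (b : Fin s → K[X]) {x : K[X]}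
    (hx : x ∈ Submodule.span K (Set.range fun p : Fin s × Fin s => b p.1 * b p.2)) :
    ∃ q : MvPolynomial (Fin s) K, q.IsHomogeneous 2 ∧ MvPolynomial.aeval b q = x := by
  induction hx using Submodule.span_induction with
  | mem y hy =>
    obtain ⟨p, rfl⟩ := hy
    refine ⟨MvPolynomial.X p.1 * MvPolynomial.X p.2,
      (MvPolynomial.isHomogeneous_X K p.1).mul (MvPolynomial.isHomogeneous_X K p.2), ?_⟩
    simp
  | zero => exact ⟨0, MvPolynomial.isHomogeneous_zero _ _ _, by simp⟩
  | add y z _ _ hy hz =>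
    obtain ⟨q₁, h₁, rfl⟩ := hy
    obtain ⟨q₂, h₂, rfl⟩ := hz
    exact ⟨q₁ + q₂, h₁.add h₂, by simp⟩
  | smul c y _ hy =>
    obtain ⟨q, hq, rfl⟩ := hy
    refine ⟨c • q, ?_, by simp⟩
    have := (MvPolynomial.homogeneousSubmodule (Fin s) K 2).smul_mem c
      ((MvPolynomial.mem_homogeneousSubmodule 2 q).mpr hq)
    exact (MvPolynomial.mem_homogeneousSubmodule 2 (c • q)).mp this

/-- **The window programme on the quartic-injective stratum.**  If `E` is realised by the
univariate polynomials `b` (`SoloUniPolyRealised b E`, the hypothesis of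
`soloInformed_valiantsHypothesis_of_unipolyLogOrderBound`), the evaluation map kills no nonzero
quartic form, and `X^a` (`a ∈ E`) has an irreducible representing quadratic form, then `a` meets
additive quadruples of `E` only trivially: `a + b' = c + d` in `E` forces `{a, b'} = {c, d}`. -/
theorem soloInformed_uniPolyRealised_sidon (b : Fin s → ℂ[X]) (E : Finset ℕ)
    (hE : SoloUniPolyRealised b E)
    (hinj : ∀ x : MvPolynomial (Fin s) ℂ, x.IsHomogeneous 4 → MvPolynomial.aeval b x = 0 → x = 0)
    {qa : MvPolynomial (Fin s) ℂ} {a b' c d : ℕ} (ha2 : qa.IsHomogeneous 2)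
    (ha : MvPolynomial.aeval b qa = (X : ℂ[X]) ^ a) (hirr : Irreducible qa)
    (hb : b' ∈ E) (hc : c ∈ E) (hd : d ∈ E) (h : a + b' = c + d) :
    (a = c ∧ b' = d) ∨ (a = d ∧ b' = c) := by
  obtain ⟨qb, hb2, hqb⟩ := solo_exists_quadForm_of_mem_span b (hE b' hb)
  obtain ⟨qc, hc2, hqc⟩ := solo_exists_quadForm_of_mem_span b (hE c hc)
  obtain ⟨qd, hd2, hqd⟩ := solo_exists_quadForm_of_mem_span b (hE d hd)
  rcases soloInformed_eq_or_eq_of_quarticInjective b hinj ha2 hb2 hc2 hd2 ha hqb hqc hqd hirr h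
    with h1 | h1
  · exact Or.inl ⟨h1, by omega⟩
  · exact Or.inr ⟨h1, by omega⟩

end Summit.ValiantsHypothesis.ValiantsHypothesis.Theorems
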